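import Summits.CriticalPhenomena.Ising3D.Control2DPolyCert2
import Summits.CriticalPhenomena.Ising3D.Control2DKernelCell
import Summits.CriticalPhenomena.Ising3D.Control2DTaylorHalf
import Mathlib.Tactic.Linarith
import Mathlib.Tactic.Positivity
import Mathlib.Tactic.Ring
import Mathlib.Tactic.FieldSimp
import Mathlib.Tactic.LinearCombination
import HarnessLib

/-!
# The region (R) of a 2D γ-certificate as ONE bivariate integer polynomial, and its kernel certificate
(cell `pub-ising3x`, seat controls-1 gen 16; KERNEL PATH for the 2D γ-certificates, step 4b — CONTROL-ONLY)

HONEST FRAMING: lottery ticket; floor = tightest certified 3D Ising CFT bounds; no exact-solution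
claim without a proof. CONTROL-ONLY (`d = 2`, `Δ_σ = 1/8`); nothing numerical is asserted here.

`gapExcluded_half_of_explicit` / `excludedOn_half_of_explicit` (g14) need the REGION hypothesis
(R) `0 ≤ Σ_p w_p c_p (q_{b+J}(p₁) q_b(p₂) + q_b(p₁) q_{b+J}(p₂))` for all real `b ≥ 0` and `J ∈ ℕ` with
`2b + J ≥ E₀`. For the `Λ = 7` tables the coefficient signs of the explicit polynomial settled it; from
`Λ = 11` on they do not. This file makes (R) a finite kernel computation for ANY integer table `wt` on an
index list `Sl` (`Δ_σ = 1/8`):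
* `regPolyZ wt Sl Λ : List (List ℤ)` — the bivariate integer polynomial `P(x, b)` (outer `x = b + J`) with
  `evalR₂_regPolyZ : P(x, b) = 8^Λ Λ!² · Σ_p w_p c_p (q_x(p₁) q_b(p₂) + q_b(p₁) q_x(p₂))` (via `qtZ`, `omegaZ`);
* SMALL `S = 2b + J ≤ S₁`: for each integer `J ≤ S₁` the univariate `zdiagJ J P = P(b + J, b)` is
  non-negative on `[max(0, (E₀-J)/2), (S₁-J)/2]` by a bisection tree of Bernstein certificates
  (`Cert₁`, `check₁`, `checkJs`);
* LARGE `S ≥ S₁`: the compactification `τ = S₁/S ∈ (0,1]`, `v = (x-b)/S ∈ [-1,1]` turns `P` into the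
  bivariate integer polynomial `qhatZ S₁ d 0 P` with `Q̂(τ, v) = (2S₁/S)^d · P(x, b)` (`evalR₂_qhatZ`), whose
  non-negativity on the box `[0,1] × [-1,1]` is a bisection tree of tensor-Bernstein certificates
  (`Cert₂`, `check₂` over `bernCheck₂`) — this covers ALL real `x - b`, a fortiori the integers;
* `region_of_kernelCert` assembles the two into hypothesis `hR` verbatim.
Measured on the cell's Λ = 11 certificates (exact mirror HOME/code/controls/kp3/kmirror2.py, gen_region3.py):
`S₁ = 2E₀ = 64`, 1–8 tensor-Bernstein leaves, 65–110 univariate leaves of degree 11 — seconds of kernel time.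
Elementary; no facts. [folklore]; large-`S` separation as in reader B of record (HOME/code/controls/rb4/verify_B2d.py).
-/

namespace Summit.CriticalPhenomena.Ising3D.Control2D

open Finset
open Literature.Analysis.ValidatedNumerics.PolyMP
open Literature.MathematicalPhysics.QuantumFieldTheory.ConformalBootstrap3D

/-! ### Bisection trees of Bernstein certificates (univariate and bivariate) -/

/-- A univariate certificate tree: a Bernstein leaf, or a bisection of the interval. [folklore] -/
inductive Cert₁ : Type
  | leaf (cs : List ℤ) : Cert₁
  | split (l r : Cert₁) : Cert₁

/-- Check a univariate certificate tree for `p ≥ 0` on `[a/q, (a+L)/q]` (children: `[2a/2q, (2a+L)/2q]`,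
`[(2a+L)/2q, (2a+2L)/2q]`). [folklore] -/
def check₁ (p : List ℤ) : ℤ → ℤ → ℤ → Cert₁ → Bool
  | q, a, L, .leaf cs => bernCheck p q a L cs
  | q, a, L, .split l r => check₁ p (2 * q) (2 * a) L l && check₁ p (2 * q) (2 * a + L) L r

/-- **Soundness of `check₁`**: `p(x) ≥ 0` whenever `a ≤ q x ≤ a + L` (`q > 0`, `L ≥ 0`). [folklore] -/
theorem evalR_nonneg_of_check₁ (p : List ℤ) : ∀ (C : Cert₁) {q a L : ℤ}, 0 < q → 0 ≤ L →
    check₁ p q a L C = true → ∀ {x : ℝ}, (a : ℝ) ≤ q * x → (q : ℝ) * x ≤ a + L →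
      0 ≤ evalR (castZ p) x
  | .leaf cs, q, a, L, hq, hL, h, x, h1, h2 => by
      have hqR : (0 : ℝ) < q := by exact_mod_cast hq
      exact evalR_nonneg_of_bernCheck hq hL h (by rw [div_le_iff₀ hqR]; linarith)
        (by rw [le_div_iff₀ hqR]; linarith)
  | .split l r, q, a, L, hq, hL, h, x, h1, h2 => by
      simp only [check₁, Bool.and_eq_true] at h
      rcases le_or_gt ((q : ℝ) * x) ((a : ℝ) + (L : ℝ) / 2) with hx | hx
      · exact evalR_nonneg_of_check₁ p l (by linarith) hL h.1 (by push_cast; linarith)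
          (by push_cast; linarith)
      · exact evalR_nonneg_of_check₁ p r (by linarith) hL h.2 (by push_cast; linarith)
          (by push_cast; linarith)

/-- A bivariate certificate tree: a tensor-Bernstein leaf, or a bisection of the outer (`splitO`) or
inner (`splitI`) variable's interval. [folklore] -/
inductive Cert₂ : Type
  | leaf (cs : List (List ℤ)) : Cert₂
  | splitO (l r : Cert₂) : Cert₂
  | splitI (l r : Cert₂) : Cert₂

/-- Check a bivariate certificate tree for `P ≥ 0` on `[a₁/q₁, (a₁+L₁)/q₁] × [a₂/q₂, (a₂+L₂)/q₂]`
(rows padded to length `n`). [folklore] -/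
def check₂ (P : List (List ℤ)) (n : ℕ) : ℤ → ℤ → ℤ → ℤ → ℤ → ℤ → Cert₂ → Bool
  | q₁, a₁, L₁, q₂, a₂, L₂, .leaf cs => bernCheck₂ P n q₁ a₁ L₁ q₂ a₂ L₂ cs
  | q₁, a₁, L₁, q₂, a₂, L₂, .splitO l r =>
      check₂ P n (2 * q₁) (2 * a₁) L₁ q₂ a₂ L₂ l && check₂ P n (2 * q₁) (2 * a₁ + L₁) L₁ q₂ a₂ L₂ r
  | q₁, a₁, L₁, q₂, a₂, L₂, .splitI l r =>
      check₂ P n q₁ a₁ L₁ (2 * q₂) (2 * a₂) L₂ l && check₂ P n q₁ a₁ L₁ (2 * q₂) (2 * a₂ + L₂) L₂ r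

/-- **Soundness of `check₂`**: `P(x, y) ≥ 0` whenever `a₁ ≤ q₁ x ≤ a₁ + L₁`, `a₂ ≤ q₂ y ≤ a₂ + L₂`
(`q₁, q₂ > 0`, `L₁, L₂ ≥ 0`). [folklore] -/
theorem evalR₂_nonneg_of_check₂ (P : List (List ℤ)) (n : ℕ) : ∀ (C : Cert₂) {q₁ a₁ L₁ q₂ a₂ L₂ : ℤ},
    0 < q₁ → 0 ≤ L₁ → 0 < q₂ → 0 ≤ L₂ → check₂ P n q₁ a₁ L₁ q₂ a₂ L₂ C = true →
      ∀ {x y : ℝ}, (a₁ : ℝ) ≤ q₁ * x → (q₁ : ℝ) * x ≤ a₁ + L₁ → (a₂ : ℝ) ≤ q₂ * y →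
        (q₂ : ℝ) * y ≤ a₂ + L₂ → 0 ≤ evalR₂ P x y
  | .leaf cs, q₁, a₁, L₁, q₂, a₂, L₂, hq₁, hL₁, hq₂, hL₂, h, x, y, h1, h2, h3, h4 => by
      have hq₁R : (0 : ℝ) < q₁ := by exact_mod_cast hq₁
      have hq₂R : (0 : ℝ) < q₂ := by exact_mod_cast hq₂
      exact evalR₂_nonneg_of_bernCheck₂ hq₁ hq₂ hL₁ hL₂ h (by rw [div_le_iff₀ hq₁R]; linarith)
        (by rw [le_div_iff₀ hq₁R]; linarith) (by rw [div_le_iff₀ hq₂R]; linarith)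
        (by rw [le_div_iff₀ hq₂R]; linarith)
  | .splitO l r, q₁, a₁, L₁, q₂, a₂, L₂, hq₁, hL₁, hq₂, hL₂, h, x, y, h1, h2, h3, h4 => by
      simp only [check₂, Bool.and_eq_true] at h
      rcases le_or_gt ((q₁ : ℝ) * x) ((a₁ : ℝ) + (L₁ : ℝ) / 2) with hx | hx
      · exact evalR₂_nonneg_of_check₂ P n l (by linarith) hL₁ hq₂ hL₂ h.1 (by push_cast; linarith)
          (by push_cast; linarith) h3 h4
      · exact evalR₂_nonneg_of_check₂ P n r (by linarith) hL₁ hq₂ hL₂ h.2 (by push_cast; linarith)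
          (by push_cast; linarith) h3 h4
  | .splitI l r, q₁, a₁, L₁, q₂, a₂, L₂, hq₁, hL₁, hq₂, hL₂, h, x, y, h1, h2, h3, h4 => by
      simp only [check₂, Bool.and_eq_true] at h
      rcases le_or_gt ((q₂ : ℝ) * y) ((a₂ : ℝ) + (L₂ : ℝ) / 2) with hy | hy
      · exact evalR₂_nonneg_of_check₂ P n l hq₁ hL₁ (by linarith) hL₂ h.1 h1 h2 (by push_cast; linarith)
          (by push_cast; linarith)
      · exact evalR₂_nonneg_of_check₂ P n r hq₁ hL₁ (by linarith) hL₂ h.2 h1 h2 (by push_cast; linarith)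
          (by push_cast; linarith)

/-! ### The region polynomial of a table -/

/-- `Σ_{a ∈ l} f a` (bivariate, coefficientwise). [folklore] -/
def zsumList₂ {α : Type*} (l : List α) (f : α → List (List ℤ)) : List (List ℤ) :=
  l.foldr (fun a acc => zadd₂ (f a) acc) []

/-- [folklore] -/
theorem evalR₂_zsumList₂ {α : Type*} (f : α → List (List ℤ)) (x y : ℝ) :
    ∀ l : List α, evalR₂ (zsumList₂ l f) x y = (l.map fun a => evalR₂ (f a) x y).sum
  | [] => by simp [zsumList₂]
  | a :: l => by
      have h := evalR₂_zsumList₂ f x y l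
      simp only [zsumList₂, List.foldr_cons, List.map_cons, List.sum_cons] at h ⊢
      rw [evalR₂_zadd₂, h]

/-- **The region polynomial** `P(x, b) = Σ_{p ∈ Sl} ω_p (Q̃_{p₁}(x) Q̃_{p₂}(b) + Q̃_{p₂}(x) Q̃_{p₁}(b))` of an
integer table `wt` on the index list `Sl` (`Δ_σ = 1/8`; `Q̃_k = 8^k k! q¹(1/8,·;k)` = `qtZ k`,
`ω_p = omegaZ Λ wt p`), outer variable `x = b + J`. Computable. [folklore] -/
def regPolyZ (wt : ℕ × ℕ → ℤ) (Sl : List (ℕ × ℕ)) (Λ : ℕ) : List (List ℤ) :=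
  zsumList₂ Sl fun p => zsmul₂ (omegaZ Λ wt p)
    (zadd₂ (zouter (qtZ p.1) (qtZ p.2)) (zouter (qtZ p.2) (qtZ p.1)))

/-- The positive scale `8^Λ (Λ!)²` between `regPolyZ` and the region sum. [folklore] -/
noncomputable def regConst (Λ : ℕ) : ℝ := 8 ^ Λ * (Λ.factorial : ℝ) * (Λ.factorial : ℝ)

/-- [folklore] -/ theorem regConst_pos (Λ : ℕ) : 0 < regConst Λ := by unfold regConst; positivity

/-- **Meaning of the region polynomial**: for a duplicate-free index list with all `p₁ + p₂ ≤ Λ`,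
`P(x, b) = 8^Λ (Λ!)² · Σ_{p} w_p (1-(-1)^{p₁+p₂}) 2^{p₁+p₂} (q_x(p₁) q_b(p₂) + q_b(p₁) q_x(p₂))` — the sum of
hypothesis `hR` of the explicit certificate theorems at `x = b + J`. [folklore] -/
theorem evalR₂_regPolyZ (wt : ℕ × ℕ → ℤ) {Sl : List (ℕ × ℕ)} (hnd : Sl.Nodup) {Λ : ℕ}
    (hΛ : ∀ p ∈ Sl, p.1 + p.2 ≤ Λ) (x b : ℝ) :
    evalR₂ (regPolyZ wt Sl Λ) x b = regConst Λ *
      ∑ p ∈ Sl.toFinset, (wt p : ℝ) * ((1 - (-1 : ℝ) ^ (p.1 + p.2)) * 2 ^ (p.1 + p.2) *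
        (qFactor₁ (1 / 8) x p.1 * qFactor₁ (1 / 8) b p.2 +
          qFactor₁ (1 / 8) b p.1 * qFactor₁ (1 / 8) x p.2)) := by
  rw [List.sum_toFinset _ hnd, regPolyZ, evalR₂_zsumList₂, ← List.sum_map_mul_left]
  congr 1
  refine List.map_congr_left fun p hp => ?_
  rw [evalR₂_zsmul₂, evalR₂_zadd₂, evalR₂_zouter, evalR₂_zouter, evalR_qtZ, evalR_qtZ, evalR_qtZ,
    evalR_qtZ]
  have hω := cast_omegaZ wt (hΛ p hp)
  unfold cfac at hω
  unfold regConst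
  linear_combination (qFactor₁ (1 / 8) x p.1 * qFactor₁ (1 / 8) b p.2 +
    qFactor₁ (1 / 8) b p.1 * qFactor₁ (1 / 8) x p.2) * hω

/-! ### Small `S`: one univariate polynomial per integer `J` -/

/-- `P(b + J, b)` as an integer coefficient list in `b` (Horner in the outer variable). [folklore] -/
def zdiagJ (J : ℕ) : List (List ℤ) → List ℤ
  | [] => []
  | r :: rs => zadd r (zmul [(J : ℤ), 1] (zdiagJ J rs))

/-- [folklore] -/
theorem evalR_zdiagJ (J : ℕ) (b : ℝ) :
    ∀ P : List (List ℤ), evalR (castZ (zdiagJ J P)) b = evalR₂ P (b + J) b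
  | [] => by simp [zdiagJ]
  | r :: rs => by
      rw [zdiagJ, evalR_zadd, evalR_zmul, evalR_zdiagJ J b rs, evalR₂_cons]
      simp only [castZ_cons, castZ_nil, evalR_cons, evalR_nil, Int.cast_natCast, Int.cast_one]
      ring

/-- Check the per-`J` univariate certificates, `J = J₀, J₀+1, …` (one tree each): `zdiagJ J P ≥ 0` on
`b ∈ [max(0, (E₀-J)/2), (S₁-J)/2]`, written as `a ≤ 2b ≤ a + L` with `a = E₀ ∸ J`, `a + L = S₁ - J`.
[folklore] -/
def checkJs (P : List (List ℤ)) (E₀ S₁ : ℕ) : ℕ → List Cert₁ → Bool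
  | _, [] => true
  | J, C :: Cs =>
      check₁ (zdiagJ J P) 2 ((E₀ - J : ℕ) : ℤ) ((S₁ - J - (E₀ - J) : ℕ) : ℤ) C && checkJs P E₀ S₁ (J + 1) Cs

/-- **Soundness of `checkJs`**: for every listed `J` and every `b ≥ 0` with `E₀ ≤ 2b + J ≤ S₁`,
`P(b + J, b) ≥ 0`. [folklore] -/
theorem evalR₂_nonneg_of_checkJs (P : List (List ℤ)) {E₀ S₁ : ℕ} (hES : E₀ ≤ S₁) :
    ∀ (Cs : List Cert₁) (J₀ : ℕ), checkJs P E₀ S₁ J₀ Cs = true →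
      ∀ J : ℕ, J₀ ≤ J → J < J₀ + Cs.length → ∀ b : ℝ, 0 ≤ b → (E₀ : ℝ) ≤ 2 * b + J →
        2 * b + J ≤ (S₁ : ℝ) → 0 ≤ evalR₂ P (b + J) b
  | [], J₀, _, J, h1, h2, b, _, _, _ => by simp at h2; omega
  | C :: Cs, J₀, h, J, h1, h2, b, hb, hE, hS => by
      simp only [checkJs, Bool.and_eq_true] at h
      rcases Nat.eq_or_lt_of_le h1 with heq | hlt
      · subst heq
        have hJS : J₀ ≤ S₁ := by exact_mod_cast (show (J₀ : ℝ) ≤ S₁ by linarith)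
        rw [← evalR_zdiagJ]
        refine evalR_nonneg_of_check₁ _ C (by norm_num) (by positivity) h.1 ?_ ?_
        · rcases le_total J₀ E₀ with hle | hge
          · push_cast [Nat.cast_sub hle]; linarith
          · rw [Nat.sub_eq_zero_of_le hge]; push_cast; linarith
        · have hsum : ((E₀ - J₀) + (S₁ - J₀ - (E₀ - J₀)) : ℕ) = S₁ - J₀ := by omega
          have hcast : (((E₀ - J₀ : ℕ) : ℤ) : ℝ) + (((S₁ - J₀ - (E₀ - J₀) : ℕ) : ℤ) : ℝ) =
              (S₁ : ℝ) - J₀ := by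
            rw [show (((E₀ - J₀ : ℕ) : ℤ) : ℝ) + (((S₁ - J₀ - (E₀ - J₀) : ℕ) : ℤ) : ℝ) =
                (((E₀ - J₀) + (S₁ - J₀ - (E₀ - J₀)) : ℕ) : ℝ) by push_cast; ring, hsum,
              Nat.cast_sub hJS]
          rw [hcast]; push_cast; linarith
      · exact evalR₂_nonneg_of_checkJs P hES Cs (J₀ + 1) h.2 J hlt (by simp at h2 ⊢; omega) b hb hE hS

/-! ### Large `S`: the compactified bivariate polynomial -/

/-- `X^n`. [folklore] -/
def zmono : ℕ → List ℤ | 0 => [1] | n + 1 => 0 :: zmono n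

/-- [folklore] -/
theorem evalR_zmono (t : ℝ) : ∀ n : ℕ, evalR (castZ (zmono n)) t = t ^ n
  | 0 => by simp [zmono]
  | n + 1 => by
      rw [zmono, castZ_cons, evalR_cons, evalR_zmono t n, Int.cast_zero, zero_add, pow_succ, mul_comm]

/-- `(1 + X)^n`. [folklore] -/
def zOnePlus : ℕ → List ℤ | 0 => [1] | n + 1 => zmul [1, 1] (zOnePlus n)

/-- [folklore] -/
theorem evalR_zOnePlus (t : ℝ) : ∀ n : ℕ, evalR (castZ (zOnePlus n)) t = (1 + t) ^ n
  | 0 => by simp [zOnePlus]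
  | n + 1 => by
      rw [zOnePlus, evalR_zmul, evalR_zOnePlus t n]
      simp only [castZ_cons, castZ_nil, evalR_cons, evalR_nil, Int.cast_one]
      ring

/-- One term `c · S₁^{i+k} 2^{d-i-k} · τ^{d-i-k} ⊗ (1+v)^i (1-v)^k` of the compactified polynomial
(outer `τ`, inner `v`). [folklore] -/
def qhatTerm (S₁ d i k : ℕ) (c : ℤ) : List (List ℤ) :=
  zsmul₂ (c * (S₁ : ℤ) ^ (i + k) * 2 ^ (d - i - k))
    (zouter (zmono (d - i - k)) (zmul (zOnePlus i) (zOneSub k)))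

/-- **The term at `τ = S₁/S`, `v = (x-b)/S`** (`S = x + b > 0`, `i + k ≤ d`):
`(2S₁/S)^d · c x^i b^k`. [folklore] -/
theorem evalR₂_qhatTerm (S₁ d i k : ℕ) (c : ℤ) (hik : i + k ≤ d) {x b : ℝ} (hS : 0 < x + b) :
    evalR₂ (qhatTerm S₁ d i k c) ((S₁ : ℝ) / (x + b)) ((x - b) / (x + b)) =
      (2 * (S₁ : ℝ) / (x + b)) ^ d * ((c : ℝ) * x ^ i * b ^ k) := by
  obtain ⟨e, rfl⟩ : ∃ e, d = i + k + e := ⟨d - i - k, by omega⟩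
  have he : i + k + e - i - k = e := by omega
  rw [qhatTerm, evalR₂_zsmul₂, evalR₂_zouter, evalR_zmono, evalR_zmul, evalR_zOnePlus, evalR_zOneSub,
    he]
  have hS0 : x + b ≠ 0 := hS.ne'
  have h1 : 1 + (x - b) / (x + b) = 2 * x / (x + b) := by field_simp; ring
  have h2 : 1 - (x - b) / (x + b) = 2 * b / (x + b) := by field_simp; ring
  rw [h1, h2]
  push_cast
  rw [div_pow, div_pow, div_pow, div_pow, pow_add, pow_add, mul_pow, mul_pow, mul_pow, pow_add, pow_add]
  field_simp
  ring

/-- The compactified image of one row (outer index `i`, inner entries from index `k` on). [folklore] -/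
def qhatRow (S₁ d i : ℕ) : ℕ → List ℤ → List (List ℤ)
  | _, [] => []
  | k, c :: cs => zadd₂ (qhatTerm S₁ d i k c) (qhatRow S₁ d i (k + 1) cs)

/-- [folklore] -/
theorem evalR₂_qhatRow (S₁ d i : ℕ) {x b : ℝ} (hS : 0 < x + b) :
    ∀ (r : List ℤ) (k : ℕ), r.length + i + k ≤ d + 1 →
      evalR₂ (qhatRow S₁ d i k r) ((S₁ : ℝ) / (x + b)) ((x - b) / (x + b)) =
        (2 * (S₁ : ℝ) / (x + b)) ^ d * (x ^ i * b ^ k * evalR (castZ r) b)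
  | [], k, _ => by simp [qhatRow]
  | c :: cs, k, h => by
      simp only [List.length_cons] at h
      rw [qhatRow, evalR₂_zadd₂, evalR₂_qhatTerm S₁ d i k c (by omega) hS,
        evalR₂_qhatRow S₁ d i hS cs (k + 1) (by omega), castZ_cons, evalR_cons]
      ring

/-- **The compactified polynomial** `Q̂ = Σ_{i,k} c_{ik} S₁^{i+k} 2^{d-i-k} τ^{d-i-k} (1+v)^i (1-v)^k` of
`P = Σ c_{ik} x^i b^k` (rows from outer index `i` on). Computable. [folklore] -/
def qhatZ (S₁ d : ℕ) : ℕ → List (List ℤ) → List (List ℤ)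
  | _, [] => []
  | i, r :: rs => zadd₂ (qhatRow S₁ d i 0 r) (qhatZ S₁ d (i + 1) rs)

/-- Degree bookkeeping: every entry `c_{ik}` of `P` (rows from outer index `i` on) has `i + k ≤ d`.
[folklore] -/
def degOK (d : ℕ) : ℕ → List (List ℤ) → Bool
  | _, [] => true
  | i, r :: rs => decide (r.length + i ≤ d + 1) && degOK d (i + 1) rs

/-- **`Q̂(S₁/S, (x-b)/S) = (2S₁/S)^d · x^i · P(x, b)`** for `S = x + b > 0` (rows from outer index `i`).
[folklore] -/
theorem evalR₂_qhatZ (S₁ d : ℕ) {x b : ℝ} (hS : 0 < x + b) :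
    ∀ (P : List (List ℤ)) (i : ℕ), degOK d i P = true →
      evalR₂ (qhatZ S₁ d i P) ((S₁ : ℝ) / (x + b)) ((x - b) / (x + b)) =
        (2 * (S₁ : ℝ) / (x + b)) ^ d * (x ^ i * evalR₂ P x b)
  | [], i, _ => by simp [qhatZ]
  | r :: rs, i, h => by
      simp only [degOK, Bool.and_eq_true, decide_eq_true_eq] at h
      rw [qhatZ, evalR₂_zadd₂, evalR₂_qhatRow S₁ d i hS r 0 (by omega), evalR₂_qhatZ S₁ d hS rs (i + 1) h.2,
        evalR₂_cons]
      ring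

/-- **Large `S` from the compactified polynomial**: if `Q̂ ≥ 0` on `[0,1] × [-1,1]` then `P(x, b) ≥ 0`
for all real `x, b ≥ 0` with `x + b ≥ S₁` (`S₁ > 0`). [folklore] -/
theorem evalR₂_nonneg_of_qhat (P : List (List ℤ)) {S₁ : ℕ} (d : ℕ) (hS₁ : 0 < S₁)
    (hdeg : degOK d 0 P = true)
    (hQ : ∀ τ v : ℝ, 0 ≤ τ → τ ≤ 1 → -1 ≤ v → v ≤ 1 → 0 ≤ evalR₂ (qhatZ S₁ d 0 P) τ v)
    {x b : ℝ} (hx : 0 ≤ x) (hb : 0 ≤ b) (hS : (S₁ : ℝ) ≤ x + b) : 0 ≤ evalR₂ P x b := by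
  have hS₁R : (0 : ℝ) < S₁ := by exact_mod_cast hS₁
  have hSpos : 0 < x + b := lt_of_lt_of_le hS₁R hS
  have h := hQ ((S₁ : ℝ) / (x + b)) ((x - b) / (x + b)) (by positivity)
    (by rw [div_le_one hSpos]; exact hS)
    (by rw [le_div_iff₀ hSpos]; linarith) (by rw [div_le_one hSpos]; linarith)
  rw [evalR₂_qhatZ S₁ d hSpos P 0 hdeg, pow_zero, one_mul] at h
  have hc : (0 : ℝ) < (2 * (S₁ : ℝ) / (x + b)) ^ d := by positivity
  exact (mul_nonneg_iff_of_pos_left hc).mp h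

/-! ### The identity obligation (I) as the sign of one integer -/

/-- `Σ_{p ∈ Sl} ω_p (-1)^{p₁+p₂} ẑ(p₁) ẑ(p₂)` with `ẑ(i) = chooseZ8 i = 8^i i! C(1/8, i)`: the identity value
`φ[F_-[1]]` of the table up to the positive factor `(1/2)^{1/4} / (8^Λ Λ!²)`. Computable. [folklore] -/
def identZ (wt : ℕ × ℕ → ℤ) (Sl : List (ℕ × ℕ)) (Λ : ℕ) : ℤ :=
  (Sl.map fun p => omegaZ Λ wt p * ((-1) ^ (p.1 + p.2) * chooseZ8 p.1 * chooseZ8 p.2)).sum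

/-- `n! · C(α, n) = α(α-1)⋯(α-n+1)`. [folklore] -/
theorem factorial_mul_choose_eq_descPochhammer (α : ℝ) (n : ℕ) :
    (n.factorial : ℝ) * Ring.choose α n = (descPochhammer ℝ n).eval α := by
  rw [choose_eq_descPochhammer_div]
  field_simp

/-- **Meaning of `identZ`**: `8^Λ Λ!² · φ[F^{1/8}_-[1]] = (1/2)^{1/8} (1/2)^{1/8} · identZ`
(`φ = taylorFunctional2D (1/2) Sl.toFinset wt`). [folklore] -/
theorem regConst_mul_taylorFunctional2D_one (wt : ℕ × ℕ → ℤ) {Sl : List (ℕ × ℕ)} (hnd : Sl.Nodup)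
    {Λ : ℕ} (hΛ : ∀ p ∈ Sl, p.1 + p.2 ≤ Λ) :
    regConst Λ * taylorFunctional2D (1 / 2) Sl.toFinset (fun p => (wt p : ℝ))
        (crossF (1 / 8) (-1) (fun _ _ => (1 : ℝ))) =
      ((1 / 2 : ℝ) ^ (1 / 8 : ℝ) * (1 / 2 : ℝ) ^ (1 / 8 : ℝ)) * (identZ wt Sl Λ : ℝ) := by
  rw [taylorFunctional2D, LinearMap.sum_apply, List.sum_toFinset _ hnd, identZ, Int.cast_list_sum,
    List.map_map, ← List.sum_map_mul_left, ← List.sum_map_mul_left]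
  congr 1
  refine List.map_congr_left fun p hp => ?_
  simp only [Function.comp_apply, LinearMap.smul_apply, smul_eq_mul, taylorCoeffAt_half_crossF_one,
    Int.cast_mul, Int.cast_pow, Int.cast_neg, Int.cast_one, cast_chooseZ8,
    ← factorial_mul_choose_eq_descPochhammer]
  have hω := cast_omegaZ wt (hΛ p hp)
  unfold cfac at hω
  unfold regConst
  linear_combination (-1 : ℝ) * ((1 / 2 : ℝ) ^ (1 / 8 : ℝ) * (1 / 2 : ℝ) ^ (1 / 8 : ℝ) *
    (-1 : ℝ) ^ (p.1 + p.2) * Ring.choose (1 / 8 : ℝ) p.1 * Ring.choose (1 / 8 : ℝ) p.2) * hω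

/-- **(I) from the kernel**: `identZ > 0` gives `φ[F^{1/8}_-[1]] > 0`. [folklore] -/
theorem ident_of_identZ_pos (wt : ℕ × ℕ → ℤ) {Sl : List (ℕ × ℕ)} (hnd : Sl.Nodup) {Λ : ℕ}
    (hΛ : ∀ p ∈ Sl, p.1 + p.2 ≤ Λ) (h : 0 < identZ wt Sl Λ) :
    0 < taylorFunctional2D (1 / 2) Sl.toFinset (fun p => (wt p : ℝ))
      (crossF (1 / 8) (-1) (fun _ _ => (1 : ℝ))) := by
  have key := regConst_mul_taylorFunctional2D_one wt hnd hΛ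
  have hpos : (0 : ℝ) < ((1 / 2 : ℝ) ^ (1 / 8 : ℝ) * (1 / 2 : ℝ) ^ (1 / 8 : ℝ)) * (identZ wt Sl Λ : ℝ) := by
    have h3 : (0 : ℝ) < (1 / 2 : ℝ) ^ (1 / 8 : ℝ) := Real.rpow_pos_of_pos (by norm_num) _
    have h4 : (0 : ℝ) < (identZ wt Sl Λ : ℝ) := by exact_mod_cast h
    positivity
  rw [← key] at hpos
  exact (mul_pos_iff_of_pos_left (regConst_pos Λ)).mp hpos

/-! ### Assembly: hypothesis `hR` from the two kernel certificates -/

/-- **The region obligation (R) of a 2D γ-certificate at `(1/2,1/2)`, `Δ_σ = 1/8`, from kernel data.**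
For the integer table `wt` on the duplicate-free index list `Sl` (all `p₁ + p₂ ≤ Λ`), thresholds
`E₀ ≤ S₁` (`S₁ > 0`), the materialised region polynomial `Plit = regPolyZ wt Sl Λ` with degree bound `d`,
a tensor-Bernstein tree `C` for its compactification on `[0,1] × [-1,1]` and univariate trees `Cs`
(one per `J = 0, …, S₁`): for all real `b ≥ 0` and `J ∈ ℕ` with `2b + J ≥ E₀`,
`0 ≤ Σ_p w_p (1-(-1)^{p₁+p₂}) 2^{p₁+p₂} (q_{b+J}(p₁) q_b(p₂) + q_b(p₁) q_{b+J}(p₂))` — hypothesis `hR`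
of `gapExcluded_half_of_explicit` / `excludedOn_half_of_explicit` verbatim. PROVED. [folklore] -/
theorem region_of_kernelCert (wt : ℕ × ℕ → ℤ) {Sl : List (ℕ × ℕ)} (hnd : Sl.Nodup) {Λ : ℕ}
    (hΛ : ∀ p ∈ Sl, p.1 + p.2 ≤ Λ) {E₀ S₁ : ℕ} (d n : ℕ) (hES : E₀ ≤ S₁) (hS₁ : 0 < S₁)
    {Plit : List (List ℤ)} (hP : regPolyZ wt Sl Λ = Plit) (hdeg : degOK d 0 Plit = true)
    (C : Cert₂) (hQ : check₂ (qhatZ S₁ d 0 Plit) n 1 0 1 1 (-1) 2 C = true)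
    (Cs : List Cert₁) (hlen : Cs.length = S₁ + 1) (hJ : checkJs Plit E₀ S₁ 0 Cs = true) :
    ∀ (b : ℝ) (J : ℕ), 0 ≤ b → (E₀ : ℝ) ≤ 2 * b + J →
      0 ≤ ∑ p ∈ Sl.toFinset, (wt p : ℝ) * ((1 - (-1 : ℝ) ^ (p.1 + p.2)) * 2 ^ (p.1 + p.2) *
        (qFactor₁ (1 / 8) (b + J) p.1 * qFactor₁ (1 / 8) b p.2 +
          qFactor₁ (1 / 8) b p.1 * qFactor₁ (1 / 8) (b + J) p.2)) := by
  intro b J hb hE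
  have hJ0 : (0 : ℝ) ≤ J := Nat.cast_nonneg J
  have key : 0 ≤ evalR₂ Plit (b + J) b := by
    rcases le_or_gt (S₁ : ℝ) (2 * b + J) with hbig | hsmall
    · refine evalR₂_nonneg_of_qhat Plit d hS₁ hdeg ?_ (x := b + J) (by positivity) hb (by linarith)
      intro τ v h0 h1 h2 h3
      exact evalR₂_nonneg_of_check₂ _ n C (by norm_num) (by norm_num) (by norm_num) (by norm_num) hQ
        (by push_cast; linarith) (by push_cast; linarith) (by push_cast; linarith)
        (by push_cast; linarith)
    · have hJle : J ≤ S₁ := by exact_mod_cast (show (J : ℝ) ≤ S₁ by linarith)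
      exact evalR₂_nonneg_of_checkJs Plit hES Cs 0 hJ J (Nat.zero_le _) (by rw [hlen]; omega) b hb hE
        hsmall.le
  rw [← hP, evalR₂_regPolyZ wt hnd hΛ] at key
  exact (mul_nonneg_iff_of_pos_left (regConst_pos Λ)).mp key

end Summit.CriticalPhenomena.Ising3D.Control2D
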